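import Literature.Geometry.Kaehler.MilnorSymbolCocycle

/-!
# Torsion units give torsion symbols in the naive Milnor relations

First lemma of the crux idea `appell-humbert-weight-p` (crux `SymbolLiftR`, stmt-HodgeConjecture-18702),
PROVED: if one entry of a good `p`-tuple `t` is pointwise an `N`-th root of unity on `W` (`N ≥ 1`),
then `N · [t] ∈ milnorRel E W p` — from the naive relations only: `N·[…,f,…] ≡ […,f^N,…]`
(multilinearity, induction on `N`), `≡ […,1,…]` (presheaf identification), `≡ 0` (multilinearity
with `f = g = 1`). This is the arithmetic reason why Appell–Humbert symbol cochains with RATIONAL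
periods close modulo the Milnor relations (`{e^{2πi r}, g} = 0` rationally).
-/

noncomputable section

open scoped Manifold
open Function

namespace Literature.Geometry.Kaehler

variable {E : Type*} [NormedAddCommGroup E] [NormedSpace ℂ E]
  {M : Type*} [TopologicalSpace M] [ChartedSpace E M]
  {W : Set M} {p : ℕ}

/-- Powers of a unit on `W` are units on `W`. [folklore] -/
theorem IsHolUnitOn.pow {f : M → ℂ} (hf : IsHolUnitOn E W f) : ∀ k : ℕ, IsHolUnitOn E W (f ^ k)
  | 0 => by simpa using isHolUnitOn_one (E := E) W
  | k + 1 => by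
    rw [pow_succ]
    exact (hf.pow k).mul hf

/-- `[…, 1, …] ∈ milnorRel`: a tuple with an entry equal to the constant `1` is a relation
(multilinearity with `fᵢ = g = 1`: `[t] - [t] - [t] = -[t]`). [folklore] -/
theorem single_update_one_mem_milnorRel {t : Fin p → M → ℂ} (ht : IsGoodTuple E W t) (i : Fin p) :
    Finsupp.single (update t i (1 : M → ℂ)) 1 ∈ milnorRel E W p := by
  set t₁ : Fin p → M → ℂ := update t i 1 with ht₁def
  have ht₁ : IsGoodTuple E W t₁ := ht.update i (isHolUnitOn_one W)
  have h := multilinear_mem_milnorRel (E := E) ht₁ i (isHolUnitOn_one (E := E) W)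
  have e1 : update t₁ i (t₁ i * 1) = t₁ := by
    rw [mul_one, update_eq_self]
  have e2 : update t₁ i (1 : M → ℂ) = t₁ := by
    rw [ht₁def, update_idem, ← ht₁def]
  rw [e1, e2, sub_self, zero_sub] at h
  exact neg_mem_iff.1 h

/-- `[…, fᵢ^k, …] - k · […, fᵢ, …] ∈ milnorRel` for `k ≥ 1` (multilinearity, induction on `k`).
[folklore] -/
theorem single_update_pow_sub_smul_mem_milnorRel {t : Fin p → M → ℂ} (ht : IsGoodTuple E W t)
    (i : Fin p) : ∀ k : ℕ, 1 ≤ k →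
      Finsupp.single (update t i (t i ^ k)) 1 - (k : ℤ) • Finsupp.single t 1 ∈ milnorRel E W p
  | 0, hk => absurd hk (by omega)
  | 1, _ => by
    have : update t i (t i ^ 1) = t := by rw [pow_one, update_eq_self]
    rw [this, Nat.cast_one, one_smul, sub_self]
    exact zero_mem _
  | k + 2, _ => by
    -- multilinearity at the tuple `[…, fᵢ^(k+1), …]` with `g = fᵢ`
    set t' : Fin p → M → ℂ := update t i (t i ^ (k + 1)) with ht'def
    have ht' : IsGoodTuple E W t' := ht.update i ((ht i).pow (k + 1))
    have hmul := multilinear_mem_milnorRel (E := E) ht' i (ht i)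
    have e1 : update t' i (t' i * t i) = update t i (t i ^ (k + 2)) := by
      rw [ht'def, update_idem, update_self, ← pow_succ]
    have e2 : update t' i (t i) = t := by
      rw [ht'def, update_idem, update_eq_self]
    rw [e1, e2] at hmul
    -- induction hypothesis at `k + 1`
    have ih := single_update_pow_sub_smul_mem_milnorRel ht i (k + 1) (by omega)
    have hsum := add_mem hmul ih
    have e3 : Finsupp.single (update t i (t i ^ (k + 2))) 1 - Finsupp.single t' 1 -
          Finsupp.single t 1 +
        (Finsupp.single (update t i (t i ^ (k + 1))) 1 - ((k + 1 : ℕ) : ℤ) • Finsupp.single t 1) =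
        Finsupp.single (update t i (t i ^ (k + 2))) (1 : ℤ) -
          ((k + 2 : ℕ) : ℤ) • Finsupp.single t 1 := by
      rw [ht'def]
      push_cast
      module
    rw [e3] at hsum
    exact hsum

/-- **Torsion units give torsion symbols.** If the `i`-th entry of a good `p`-tuple `t` on `W` is
pointwise an `N`-th root of unity on `W`, `N ≥ 1`, then `N · [t]` lies in the naive Milnor
relations over `W` (`{…, ζ, …}` is `N`-torsion; over `ℚ` it dies). [folklore] -/
theorem nsmul_single_mem_milnorRel_of_pow_eq_one {t : Fin p → M → ℂ} (ht : IsGoodTuple E W t)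
    (i : Fin p) {N : ℕ} (hN : 0 < N) (h : ∀ x ∈ W, t i x ^ N = 1) :
    (N : ℤ) • Finsupp.single t (1 : ℤ) ∈ milnorRel E W p := by
  -- (1) `[…, fᵢ^N, …] - N [t] ∈ Rel`
  have h1 := single_update_pow_sub_smul_mem_milnorRel (E := E) ht i N hN
  -- (2) `[…, fᵢ^N, …] - […, 1, …] ∈ Rel` (the two tuples agree on `W`)
  have h2 : Finsupp.single (update t i (t i ^ N)) 1 - Finsupp.single (update t i (1 : M → ℂ)) 1 ∈
      milnorRel E W p := by
    refine single_sub_single_mem_milnorRel (ht.update i ((ht i).pow N))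
      (ht.update i (isHolUnitOn_one W)) fun j x hx ↦ ?_
    rcases eq_or_ne j i with rfl | hj
    · simp only [update_self, Pi.pow_apply, Pi.one_apply]
      exact h x hx
    · simp only [update_of_ne hj]
  -- (3) `[…, 1, …] ∈ Rel`
  have h3 := single_update_one_mem_milnorRel (E := E) ht i
  -- combine: `N[t] = -(h1) + h2 + h3`
  have key : (N : ℤ) • Finsupp.single t (1 : ℤ) =
      -(Finsupp.single (update t i (t i ^ N)) 1 - (N : ℤ) • Finsupp.single t 1) +
        (Finsupp.single (update t i (t i ^ N)) 1 - Finsupp.single (update t i (1 : M → ℂ)) 1) +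
        Finsupp.single (update t i (1 : M → ℂ)) 1 := by
    abel
  rw [key]
  exact add_mem (add_mem (neg_mem h1) h2) h3

end Literature.Geometry.Kaehler

end
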